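import Summits.BirchSwinnertonDyer.Rank1Residual.F1Sign2.SignedSubgroupsAtTwo
import Mathlib.Tactic.IntervalCases
import HarnessLib

/-!
# Kernel sibling of `SignedSubgroupsAtTwo.lean` (cell `bsd-f1-sign2`, D-imc-60; typer -ty g20)

THEOREMS ONLY, all proved (`decide`, tree lemmas); no `def`, no `sorry`, no instance, no named fact.  Three blocks:
* -imc g20's kernel-decided exponent tables from `Sketch62.lean` e8b98cffdbb0a0b0 (l.143–150 VERBATIM; pure arithmetic, no row of the statements file is referenced): `signedSpanIndexFloorLaw_exponents` (C1′ exponents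
  `Σ_{m ≤ n} ⌊2^m/15⌋ = 0,0,0,0,1,3,7,15,32,66` for n = 0..9) and `signedSpanIndexLaws_agree_le_seven` (the refuted C1's exponent `2^(n−3) − 1` agrees with C1′'s for
  n ≤ 7 and `31 ≠ 32` at n = 8 — the registered falsifier kit j334501 returned 32);
* REF1-AUDIT §228's BC7 certificates from `HOME/REF1-data/b228/Probe228.lean` c3ba1643cb05fc5f (l.131–195 VERBATIM, `example`s and the theorem `minus_one_eq_layer`;
  BC7-c omitted because it is a consequence of the refuted C1 — its C1′ analogue is the typer glue): (a) `relIndex` orientation, (b) the reversed orientation is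
  identically `1`, (d) layer `0`, (e) layer `1` (`E⁻_1 = E(k_1)`, `E⁺_1 ⊔ E⁻_1 = E(k_1)` for every type), (f) `localTrace n (n+2)` lands in layer `n`, (g) the double trace
  on the bottom layer is multiplication by the index;
* typer glue (v1): `floorExponent_eq_zero_of_le_three` (ℕ-division: the C1′ exponent vanishes for `n ≤ 3`), `floorExponent_layers` (the exponent at n = 4..10 is 1, 3, 7, 15, 32,
  66, 134 = MEMO-imc §10.100-add1's list), `span_layer_one` (C2 at `n = 1` by definition, every type), `layer_zero_le_meet` (the tree half of C3).  The glue that mentions the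
  Sketch62 rows (`floorLaw_span_of_le_three`, the proof C5 ∧ C6 ⟹ C1′, `spanIndex_of_rows`) is staged and lands with their append (see the statements file's STATUS line).
Nothing here bears on BSD; 23715 not closed.  [cite: Kobayashi2003, Def. 1.1, Prop. 8.12]
-/

namespace Summit.BirchSwinnertonDyer.Rank1Residual.F1Sign2.SignedSubgroupsAtTwo.Kernel

open Literature.NumberTheory.EllipticCurves Literature.NumberTheory.EllipticCurves.Kobayashi2003
  ZpExtension WeierstrassCurve
  Summit.BirchSwinnertonDyer.Rank1Residual.F1Sign2.SignedSubgroupsAtTwo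

/-! ## -imc g20 (Sketch62 l.143–150 VERBATIM): the exponents of C1′ and the comparison with the refuted C1 -/

/-- The exponents of C1′ for n = 0..9 (ℕ-division = floor): 0,0,0,0,1,3,7,15,32,66. -/
theorem signedSpanIndexFloorLaw_exponents :
    (List.range 10).map (fun n => (Finset.range (n + 1)).sum fun m => 2 ^ m / 15) = [0, 0, 0, 0, 1, 3, 7, 15, 32, 66] := by
  decide

/-- C1 and C1′ agree for n ≤ 7 and part at n = 8. -/
theorem signedSpanIndexLaws_agree_le_seven :
    (List.range 8).map (fun n => 2 ^ (n - 3) - 1) = (List.range 8).map (fun n => (Finset.range (n + 1)).sum fun m => 2 ^ m / 15)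
    ∧ (2 ^ (8 - 3) - 1 : ℕ) ≠ (Finset.range 9).sum (fun m => 2 ^ m / 15) := by
  refine ⟨by decide, by decide⟩

/-! ## REF1-AUDIT §228 BC7 certificates (Probe228.lean c3ba1643cb05fc5f l.131–195 VERBATIM, minus BC7-c which concerns the refuted C1; its C1′ analogue is the typer glue below) -/

/-- BC7-a (relIndex ORIENTATION): `H.relIndex K = 1 ↔ K ≤ H`, i.e. `H.relIndex K = [K : H ⊓ K]`; so C1's
`(E⁺ ⊔ E⁻).relIndex E(k_n)` IS `[E(k_n) : E⁺ + E⁻]` (the other order would be identically `1`). -/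
example {G : Type*} [AddGroup G] (H K : AddSubgroup G) : H.relIndex K = 1 ↔ K ≤ H := AddSubgroup.relIndex_eq_one

/-- BC7-b (the reversed orientation is trivial): `E(k_n).relIndex (E⁺ ⊔ E⁻) = 1` always, since `E⁺ ⊔ E⁻ ≤ E(k_n)`. -/
example (W : WeierstrassCurve ℚ) (κ : ZpExtension ℚ 2) (n : ℕ) :
    (localLayerPoints κ ℚ_[2] W n).relIndex
      (signedLocalPoints κ ℚ_[2] W 1 n ⊔ signedLocalPoints κ ℚ_[2] W (-1) n) = 1 :=
  AddSubgroup.relIndex_eq_one.mpr (sup_le (signedLocalPointsOfEmb_le _ _ W 1 n) (signedLocalPointsOfEmb_le _ _ W (-1) n))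

/-- BC7-d (degenerate layer n = 0): `E^ε_0 = E(k_0)`, so C2, C3 (and C1: index 1) hold at `n = 0` by definition. -/
example (W : WeierstrassCurve ℚ) (κ : ZpExtension ℚ 2) :
    signedLocalPoints κ ℚ_[2] W 1 0 ⊓ signedLocalPoints κ ℚ_[2] W (-1) 0 = localLayerPoints κ ℚ_[2] W 0 := by
  rw [show signedLocalPoints κ ℚ_[2] W 1 0 = localLayerPoints κ ℚ_[2] W 0 from signedLocalPointsOfEmb_zero _ _ W 1,
      show signedLocalPoints κ ℚ_[2] W (-1) 0 = localLayerPoints κ ℚ_[2] W 0 from signedLocalPointsOfEmb_zero _ _ W (-1)]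
  exact inf_idem _

/-- BC7-e (degenerate layer n = 1): the minus condition is EMPTY below layer 1 (no odd `m < 1`), so `E⁻_1 = E(k_1)`
and hence `E⁺_1 ⊔ E⁻_1 = E(k_1)`: C1 (index `2^0 = 1`) and C2 hold at `n = 1` by definition, for every type. -/
theorem minus_one_eq_layer (W : WeierstrassCurve ℚ) (κ : ZpExtension ℚ 2) :
    signedLocalPoints κ ℚ_[2] W (-1) 1 = localLayerPoints κ ℚ_[2] W 1 := by
  ext P
  rw [mem_signedLocalPointsOfEmb_neg_one_iff]
  constructor
  · exact fun h => h.1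
  · intro h
    refine ⟨h, fun m hm hodd => ?_⟩
    obtain rfl : m = 0 := Nat.lt_one_iff.mp hm
    exact absurd hodd (by decide)

example (W : WeierstrassCurve ℚ) (κ : ZpExtension ℚ 2) :
    signedLocalPoints κ ℚ_[2] W 1 1 ⊔ signedLocalPoints κ ℚ_[2] W (-1) 1 = localLayerPoints κ ℚ_[2] W 1 := by
  rw [minus_one_eq_layer]
  exact sup_eq_right.mpr (signedLocalPointsOfEmb_le _ _ W 1 1)

/-- BC7-f (localTrace ORIENTATION `localTrace m n = Tr_{n/m}`): C4's `localTrace κ ℚ_[2] W n (n+2) P` lands in layer `n`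
for `P ∈ E(k_{n+2})` (tree lemma), as a trace `Tr_{n+2/n}` must. -/
example (W : WeierstrassCurve ℚ) (κ : ZpExtension ℚ 2) (n : ℕ) (P : localPoints W ℚ_[2])
    (hP : P ∈ localLayerPoints κ ℚ_[2] W (n + 2)) :
    localTrace κ ℚ_[2] W n (n + 2) P ∈ localLayerPoints κ ℚ_[2] W n :=
  localTraceOfEmb_mem_of_mem _ _ W n (n + 2) hP

/-- BC7-g (C4 is not vacuous-by-junk on the bottom of the tower): on `P ∈ E(k_n)` itself the double trace is
multiplication by the index `[Gal(k̄/k_n) : Gal(k̄/k_{n+2})]`, a divisor of a power of 2 — the statement there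
reduces to `index • P ∈ 2 • E(k_{n+2})`, true iff the index is even OR `P ∈ 2E`; so C4 carries content only through
the index being `4` (not kernel-available as an equality: the tree has `index ∣ 2^(n+2)` only). -/
example (W : WeierstrassCurve ℚ) (κ : ZpExtension ℚ 2) (n : ℕ) (P : localPoints W ℚ_[2])
    (hP : P ∈ localLayerPoints κ ℚ_[2] W n) :
    localTrace κ ℚ_[2] W n (n + 2) P =
      ((localLayerSubgroupOfEmb κ (closureEmb (K := ℚ) ℚ_[2]) (n + 2)).subgroupOf
        (localLayerSubgroupOfEmb κ (closureEmb (K := ℚ) ℚ_[2]) n)).index • P :=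
  localTraceOfEmb_apply_of_mem_lower _ _ W n (n + 2) hP

/-! ## Typer glue (-ty g20) -/

/-- ℕ-division in C1′: for `n ≤ 3` every summand `2^m / 15`, `m ≤ n`, vanishes (`2^m ≤ 8 < 15`), so the C1′ exponent is `0` there. -/
theorem floorExponent_eq_zero_of_le_three (n : ℕ) (hn : n ≤ 3) :
    ((Finset.range (n + 1)).sum fun m => 2 ^ m / 15) = 0 := by
  interval_cases n <;> decide

/-- The C1′ exponent at the layers `n = 4, …, 10`: `1, 3, 7, 15, 32, 66, 134` (MEMO-imc §10.100-add1; per-layer defects `⌊2ⁿ/15⌋ = 1, 2, 4, 8, 17, 34, 68`). -/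
theorem floorExponent_layers :
    ((List.range 7).map fun i => (Finset.range (i + 5)).sum fun m => 2 ^ m / 15) = [1, 3, 7, 15, 32, 66, 134]
    ∧ ((List.range 7).map fun i => 2 ^ (i + 4) / 15) = [1, 2, 4, 8, 17, 34, 68] := by
  refine ⟨by decide, by decide⟩

/-- C2 at the degenerate layer `n = 1` is definitionally true for EVERY type (BC7-e), so `SignedSpanAtTwoOfTraceZero` carries content from `n = 2` only. -/
theorem span_layer_one (W : WeierstrassCurve ℚ) (κ : ZpExtension ℚ 2) :
    signedLocalPoints κ ℚ_[2] W 1 1 ⊔ signedLocalPoints κ ℚ_[2] W (-1) 1 = localLayerPoints κ ℚ_[2] W 1 := by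
  rw [minus_one_eq_layer]
  exact sup_eq_right.mpr (signedLocalPointsOfEmb_le _ _ W 1 1)

/-- The containment `E(ℚ₂) = E(k_0) ≤ E⁺_n ⊓ E⁻_n` of C3 is the tree lemma (both signs); C3's content is the reverse inclusion. -/
theorem layer_zero_le_meet (W : WeierstrassCurve ℚ) (κ : ZpExtension ℚ 2) (n : ℕ) :
    localLayerPoints κ ℚ_[2] W 0 ≤ signedLocalPoints κ ℚ_[2] W 1 n ⊓ signedLocalPoints κ ℚ_[2] W (-1) n :=
  le_inf (localLayerPointsOfEmb_zero_le_signedLocalPointsOfEmb _ _ W 1 n)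
    (localLayerPointsOfEmb_zero_le_signedLocalPointsOfEmb _ _ W (-1) n)

end Summit.BirchSwinnertonDyer.Rank1Residual.F1Sign2.SignedSubgroupsAtTwo.Kernel
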